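import Mathlib
import Literature.Analysis.FluidPDE.ClassicalSolution
import Literature.Analysis.FluidPDE.VorticityCalculus
import Summits.NavierStokesRegularity.NavierStokesRegularity.Theorems.ThreadingFluxHorizonTowerDefs
import Summits.NavierStokesRegularity.NavierStokesRegularity.Theorems.ThreadingFluxHorizonTowerSecondJetHeadForm
import Summits.NavierStokesRegularity.NavierStokesRegularity.Theorems.ThreadingFluxHorizonTowerTailRung
import Summits.NavierStokesRegularity.NavierStokesRegularity.Theorems.ThreadingFluxHorizonBlowdownRescaledLimit
import Summits.NavierStokesRegularity.NavierStokesRegularity.Theorems.ThreadingFluxHorizonOrderTwoLawBlowdownTools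
import HarnessLib

/-!
# Crux `PoloidalLiouville` (stmt-NavierStokesRegularity-1222, W1), crux idea «horizon-threading-tower» (ns-idea-15):
# THE ORDER-TWO HORIZON LAW (the LEVER, sketch Prop `OrderTwoHorizonLaw`, `ThreadingFluxHorizonTowerDefs` l.158) — PROVED

A classical Navier–Stokes solution (`ν = 1`, no force) on an open window `S ∋ t₀` whose slice at `t₀` is UNTHREADED about `x₀`
(`⟪curl u(t₀) x, x − x₀⟫ = 0` for all `x`) and has a SCALE-FREE FAR FIELD — `u(t₀) = U + O(r^{−δ})` with six derivatives,
`p(t₀) = P₀ + s₀ log r + O(r^{−δ})` with two, `U` degree-0 homogeneous and smooth off `x₀`, `P₀` dilation invariant and smooth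
off `x₀` — satisfies, for every unit vector `ξ`,

`ρ² ∂ₜ²F(t₀, x₀ + ρ ξ) ⟶ 𝔏₂[U](ξ) = horizonL2 U x₀ (x₀ + ξ)`   as `ρ → ∞`:

at the horizon the order-two threading coefficient is LOCAL and PRESSURE-FREE (`orderTwoHorizonLaw`, body verbatim = the
sketch Prop; `orderTwoHorizonLaw_holds : OrderTwoHorizonLaw` closes the Theorems-side twin BY NAME; with the landed conditional
rung `boundedEndpointTailRung_of_orderTwoHorizonLaw` the bounded-endpoint TAIL RUNG becomes unconditional:
`boundedEndpointTailRung_holds : BoundedEndpointTailRung`).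

Proof.  By `HorizonTower.secondJetHeadForm` (slice unthreaded), `∂ₜ²F(t₀, x) = Loc₂[w](x) − ⟪curl w, ∇(radialVirial (head w q) x₀)⟫(x)`
with `w = u t₀`, `q = p t₀`.  `atTop` on `ℝ` is countably generated, so it suffices to treat sequences `ρₖ → ∞`.  The power tails
give, at the point `ξ`, jet convergence of `y ↦ w(x₀ + ρₖ y)` to (a global `C⁶` cut-off representative `V` of) `y ↦ U(x₀ + y)` with
six derivatives and of `y ↦ q(x₀ + ρₖ y) − s₀ log ρₖ` to (a `C²` representative `Q` of) `y ↦ P₀(x₀ + y) + s₀ log ‖y‖` with two: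
`‖Dʲ[(w − U)(x₀ + ρₖ ·)](ξ)‖ ≤ ρₖʲ ‖Dʲ(w − U)(x₀ + ρₖ ξ)‖ ≤ C ρₖ^{−δ} → 0` (`OrderTwoLaw.norm_iteratedFDeriv_comp_affine_le`, the
tails read through global cut-offs `OrderTwoLaw.exists_contDiff_far` of `U`, `P₀ + s₀ log r` away from the centre, homogeneity
`U(x₀ + ρ y) = U(x₀ + y)`, `log (ρ‖y‖) = log ρ + log ‖y‖`).  The analytic core `OrderTwoBlowdown.tendsto_rescaled_loc2_sub_head`
then gives the limit `⟪ξ, 𝔏₂-bracket of V⟫(ξ) − ⟪curl V ξ, ∇(radialVirial (head V Q) 0) ξ⟫`; the head part vanishes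
(`OrderTwoBlowdown.radialVirial_head_eventuallyEq_const`: the radial virial of the limit head is the constant `s₀`), and the
bracket is `horizonL2 V 0 ξ = horizonL2 (U(x₀ + ·)) 0 ξ = horizonL2 U x₀ (x₀ + ξ)` (`‖ξ‖ = 1`, germ-locality, translation).

BOOKING: LEVER rung of the horizon card (information-grade far-field asymptotics of `c₂`; below W1); ⟨1222⟩ stays OPEN;
NS regularity is NOT proved by any of this.
-/

-- the summit and its single problem share the name (D-0017 nested layout)
set_option linter.dupNamespace false

noncomputable section

namespace Summit.NavierStokesRegularity.NavierStokesRegularity.Theorems.PoloidalLiouville.HorizonTower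

open Set Function Filter Topology Metric
open scoped Topology RealInnerProductSpace Laplacian ContDiff
open Literature.Analysis.FluidPDE

namespace OrderTwoLaw

/-- GLOBAL CUT-OFF AWAY FROM THE CENTRE: a function that is `C^n` off `x₀` agrees, near every point with `‖x − x₀‖ > 1/2`, with a
globally `C^n` function. -/
theorem exists_contDiff_far {F : Type*} [NormedAddCommGroup F] [NormedSpace ℝ F] {n : ℕ} {f : E3 → F} {x₀ : E3}
    (hf : ContDiffOn ℝ n f {x₀}ᶜ) :
    ∃ g : E3 → F, ContDiff ℝ n g ∧ ∀ x : E3, 1 / 2 < ‖x - x₀‖ → g =ᶠ[𝓝 x] f := by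
  have hopen : IsOpen ({x₀}ᶜ : Set E3) := isOpen_compl_singleton
  let χ : ContDiffBump x₀ := ⟨1 / 4, 1 / 2, by norm_num, by norm_num⟩
  refine ⟨fun y => (1 - χ y) • f y, ?_, ?_⟩
  · rw [contDiff_iff_contDiffAt]
    intro y
    by_cases hy : y = x₀
    · have hzero : (fun y => (1 - χ y) • f y) =ᶠ[𝓝 y] fun _ => (0 : F) := by
        subst hy
        filter_upwards [isOpen_ball.mem_nhds (mem_ball_self (by norm_num : (0:ℝ) < 1 / 4))] with y' hy'
        show (1 - χ y') • f y' = 0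
        rw [χ.one_of_mem_closedBall (ball_subset_closedBall hy'), sub_self, zero_smul]
      exact contDiffAt_const.congr_of_eventuallyEq hzero
    · exact (contDiffAt_const.sub (χ.contDiff (n := n)).contDiffAt).smul
        ((hf y hy).contDiffAt (hopen.mem_nhds hy))
  · intro x hx
    have hcont : Continuous fun y : E3 => dist y x₀ := continuous_id.dist continuous_const
    have hx' : 1 / 2 < dist x x₀ := by rwa [dist_eq_norm]
    filter_upwards [hcont.continuousAt.eventually (Ioi_mem_nhds hx')] with y hy
    show (1 - χ y) • f y = f y
    rw [χ.zero_of_le_dist (le_of_lt hy), sub_zero, one_smul]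

/-- SCALING BOUND FOR JETS: for a globally `C^n` function `G` and `j ≤ n`,
`‖Dʲ[y ↦ G(x₀ + c y)](z)‖ ≤ |c|ʲ ‖DʲG(x₀ + c z)‖`. -/
theorem norm_iteratedFDeriv_comp_affine_le {F : Type*} [NormedAddCommGroup F] [NormedSpace ℝ F] {n : ℕ} {G : E3 → F}
    (hG : ContDiff ℝ n G) (x₀ : E3) (c : ℝ) (z : E3) {j : ℕ} (hj : j ≤ n) :
    ‖iteratedFDeriv ℝ j (fun y : E3 => G (x₀ + c • y)) z‖ ≤ |c| ^ j * ‖iteratedFDeriv ℝ j G (x₀ + c • z)‖ := by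
  set L : E3 →L[ℝ] E3 := c • ContinuousLinearMap.id ℝ E3 with hL
  have hG₁ : ContDiff ℝ n (fun v : E3 => G (x₀ + v)) := hG.comp (contDiff_const.add contDiff_id)
  have hfun : (fun y : E3 => G (x₀ + c • y)) = (fun v : E3 => G (x₀ + v)) ∘ L := by
    funext y; simp [hL]
  rw [hfun, L.iteratedFDeriv_comp_right hG₁ z (by exact_mod_cast hj)]
  have htr : iteratedFDeriv ℝ j (fun v : E3 => G (x₀ + v)) (L z) = iteratedFDeriv ℝ j G (x₀ + c • z) := by
    rw [iteratedFDeriv_comp_add_left]; simp [hL]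
  refine (ContinuousMultilinearMap.norm_compContinuousLinearMap_le _ _).trans ?_
  rw [htr, Finset.prod_const, Finset.card_univ, Fintype.card_fin, mul_comm]
  gcongr
  calc ‖L‖ ≤ ‖c‖ * ‖ContinuousLinearMap.id ℝ E3‖ := by rw [hL]; exact norm_smul_le c (ContinuousLinearMap.id ℝ E3)
    _ ≤ |c| * 1 := by rw [Real.norm_eq_abs]; gcongr; exact ContinuousLinearMap.norm_id_le
    _ = |c| := mul_one _

/-- POWER TAIL ⇒ POINTWISE JET DECAY OF THE RESCALINGS: if `‖Dʲ(f − g)(x)‖ ≤ C ‖x − x₀‖^{−(j+δ)}` for `‖x − x₀‖ ≥ 1`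
with `f`, `g` globally `C^n` (`j ≤ n`), `ρₖ → ∞`, and the functions `Tₖ` agree near `z ≠ 0` with `y ↦ (f − g)(x₀ + ρₖ y)` for
all large `k`, then `‖Dʲ Tₖ (z)‖ → 0`:  `‖Dʲ[(f − g)(x₀ + ρₖ ·)](z)‖ ≤ ρₖʲ ‖Dʲ(f − g)(x₀ + ρₖ z)‖ ≤ C ‖z‖^{−(j+δ)} ρₖ^{−δ}`. -/
theorem tendsto_norm_iteratedFDeriv_rescale {F : Type*} [NormedAddCommGroup F] [NormedSpace ℝ F] {n : ℕ}
    {f g : E3 → F} {T : ℕ → E3 → F} {x₀ z : E3} {C δ : ℝ} (hδ : 0 < δ) (hz : z ≠ 0) (hf : ContDiff ℝ n f)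
    (hg : ContDiff ℝ n g) {j : ℕ} (hj : j ≤ n)
    (htail : ∀ x : E3, 1 ≤ ‖x - x₀‖ → ‖iteratedFDeriv ℝ j (fun y => f y - g y) x‖ ≤ C * ‖x - x₀‖ ^ (-((j : ℝ) + δ)))
    {ρ : ℕ → ℝ} (hρ : Tendsto ρ atTop atTop)
    (hT : ∀ᶠ k in atTop, T k =ᶠ[𝓝 z] fun y => f (x₀ + ρ k • y) - g (x₀ + ρ k • y)) :
    Tendsto (fun k => ‖iteratedFDeriv ℝ j (T k) z‖) atTop (𝓝 0) := by
  have hzpos : 0 < ‖z‖ := norm_pos_iff.mpr hz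
  have hρ1 : ∀ᶠ k in atTop, ‖z‖⁻¹ ⊔ 1 ≤ ρ k := hρ.eventually_ge_atTop _
  -- the bound `C ‖z‖^{-(j+δ)} ρₖ^{-δ} → 0`
  have hlim : Tendsto (fun k => C * ‖z‖ ^ (-((j : ℝ) + δ)) * (ρ k) ^ (-δ)) atTop (𝓝 0) := by
    have h := ((tendsto_rpow_neg_atTop hδ).comp hρ).const_mul (C * ‖z‖ ^ (-((j : ℝ) + δ)))
    rw [mul_zero] at h
    exact h
  refine squeeze_zero' (Eventually.of_forall fun k => norm_nonneg _) ?_ hlim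
  filter_upwards [hρ1, hT] with k hk hTk
  have hk1 : 1 ≤ ρ k := le_trans le_sup_right hk
  have hkpos : 0 < ρ k := lt_of_lt_of_le one_pos hk1
  have hkz : 1 ≤ ‖(x₀ + ρ k • z) - x₀‖ := by
    rw [add_sub_cancel_left, norm_smul, Real.norm_eq_abs, abs_of_pos hkpos]
    have h := mul_le_mul_of_nonneg_right (le_trans le_sup_left hk) hzpos.le
    rwa [inv_mul_cancel₀ hzpos.ne'] at h
  rw [(hTk.iteratedFDeriv ℝ j).eq_of_nhds]
  refine (norm_iteratedFDeriv_comp_affine_le (hf.sub hg) x₀ (ρ k) z hj).trans ?_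
  rw [abs_of_pos hkpos]
  refine (mul_le_mul_of_nonneg_left (htail _ hkz) (pow_nonneg hkpos.le _)).trans (le_of_eq ?_)
  rw [add_sub_cancel_left, norm_smul, Real.norm_eq_abs, abs_of_pos hkpos,
    Real.mul_rpow hkpos.le hzpos.le, ← Real.rpow_natCast]
  have h1 : (ρ k) ^ ((j : ℕ) : ℝ) * (ρ k) ^ (-((j : ℝ) + δ)) = (ρ k) ^ (-δ) := by
    rw [← Real.rpow_add hkpos]; congr 1; ring
  calc (ρ k) ^ ((j : ℕ) : ℝ) * (C * ((ρ k) ^ (-((j : ℝ) + δ)) * ‖z‖ ^ (-((j : ℝ) + δ))))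
      = C * ‖z‖ ^ (-((j : ℝ) + δ)) * ((ρ k) ^ ((j : ℕ) : ℝ) * (ρ k) ^ (-((j : ℝ) + δ))) := by ring
    _ = C * ‖z‖ ^ (-((j : ℝ) + δ)) * (ρ k) ^ (-δ) := by rw [h1]

end OrderTwoLaw

/-- **THE ORDER-TWO HORIZON LAW** (the sketch Prop `OrderTwoHorizonLaw`, `ThreadingFluxHorizonTowerDefs` l.158, BODY VERBATIM —
closes it by name): for a classical NS solution on an open window whose slice at `t₀` is unthreaded about `x₀` and has the
scale-free far field `u(t₀) = U + O(r^{−δ})` (six derivatives), `p(t₀) = P₀ + s₀ log r + O(r^{−δ})` (two derivatives) with `U`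
degree-0 homogeneous and `P₀` dilation invariant (both smooth off `x₀`), `ρ² ∂ₜ²F(t₀, x₀ + ρξ) → horizonL2 U x₀ (x₀ + ξ)` as
`ρ → ∞` for every unit vector `ξ`. -/
theorem orderTwoHorizonLaw :
    ∀ (S : Set ℝ) (u : ℝ → E3 → E3) (p : ℝ → E3 → ℝ) (x₀ : E3) (t₀ : ℝ) (U : E3 → E3) (P₀ : E3 → ℝ) (s₀ δ C : ℝ),
    IsOpen S → t₀ ∈ S → Literature.Analysis.FluidPDE.IsClassicalNSSolutionOn S 1 0 u p → 0 < δ →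
    ContDiffOn ℝ (⊤ : ℕ∞) U {x₀}ᶜ → IsZeroHomogeneousAbout x₀ U →
    ContDiffOn ℝ (⊤ : ℕ∞) P₀ {x₀}ᶜ → (∀ c : ℝ, 0 < c → ∀ y : E3, P₀ (x₀ + c • y) = P₀ (x₀ + y)) →
    (∀ k ≤ 6, ∀ x : E3, 1 ≤ ‖x - x₀‖ →
        ‖iteratedFDeriv ℝ k (fun z => u t₀ z - U z) x‖ ≤ C * ‖x - x₀‖ ^ (-((k : ℝ) + δ))) →
    (∀ k ≤ 2, ∀ x : E3, 1 ≤ ‖x - x₀‖ →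
        ‖iteratedFDeriv ℝ k (fun z => p t₀ z - P₀ z - s₀ * Real.log ‖z - x₀‖) x‖ ≤ C * ‖x - x₀‖ ^ (-((k : ℝ) + δ))) →
    (∀ x, threadingFlux u x₀ t₀ x = 0) →
    ∀ ξ : E3, ‖ξ‖ = 1 →
      Tendsto (fun ρ : ℝ => ρ ^ 2 * iteratedDeriv 2 (fun t => threadingFlux u x₀ t (x₀ + ρ • ξ)) t₀) atTop
        (𝓝 (horizonL2 U x₀ (x₀ + ξ))) := by
  intro S u p x₀ t₀ U P₀ s₀ δ C hS ht₀ hNS hδ hU hUhom hP hPhom hTu hTp hF ξ hξ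
  have hξ0 : ξ ≠ 0 := by
    intro h; rw [h, norm_zero] at hξ; exact zero_ne_one hξ
  have hopen : IsOpen ({x₀}ᶜ : Set E3) := isOpen_compl_singleton
  /- the slice, its pressure, smoothness -/
  set w : E3 → E3 := u t₀ with hw
  set q : E3 → ℝ := p t₀ with hq
  have hinS : ∀ x : E3, (t₀, x) ∈ S ×ˢ (univ : Set E3) := fun x => ⟨ht₀, mem_univ _⟩
  have hws : ContDiff ℝ (⊤ : ℕ∞) w := hNS.smooth_velocity.comp_contDiff (contDiff_const.prodMk contDiff_id) hinS
  have hqs : ContDiff ℝ (⊤ : ℕ∞) q := hNS.smooth_pressure.comp_contDiff (contDiff_const.prodMk contDiff_id) hinS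
  /- `∂ₜ²F(t₀, x) = Loc₂[w](x) − head term` (p676921) -/
  have hjet : ∀ x : E3, iteratedDeriv 2 (fun t => threadingFlux u x₀ t x) t₀
      = loc2 w x₀ x - inner ℝ (curl w x) (gradient (radialVirial (head w q) x₀) x) :=
    secondJetHeadForm S u p x₀ t₀ hS ht₀ hNS hF
  /- the limit objects, centred at `0`: `U' = U(x₀ + ·)`, `P' = P₀(x₀ + ·)` -/
  set U' : E3 → E3 := fun y => U (x₀ + y) with hU'
  set P' : E3 → ℝ := fun y => P₀ (x₀ + y) with hP'
  have hmaps : MapsTo (fun y : E3 => x₀ + y) ({0}ᶜ : Set E3) ({x₀}ᶜ : Set E3) := by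
    intro y hy h
    exact hy (by simpa using h)
  have hU'C : ContDiffOn ℝ 6 U' {0}ᶜ :=
    (hU.of_le (by norm_cast)).comp (contDiff_const.add contDiff_id).contDiffOn hmaps
  have hP'C : ContDiffOn ℝ 2 P' {0}ᶜ :=
    (hP.of_le (by norm_cast)).comp (contDiff_const.add contDiff_id).contDiffOn hmaps
  have hU'hom : IsZeroHomogeneousAbout 0 U' := by
    intro c hc y
    show U (x₀ + (0 + c • y)) = U (x₀ + (0 + y))
    rw [zero_add, zero_add]; exact hUhom c hc y
  have hP'hom : ∀ c : ℝ, 0 < c → ∀ y : E3, P' (c • y) = P' y := fun c hc y => hPhom c hc y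
  have hP'infC : ContDiffOn ℝ 2 (fun y => P' y + s₀ * Real.log ‖y‖) {0}ᶜ := by
    refine hP'C.add (contDiffOn_const.mul ?_)
    intro y hy
    have hy' : (y : E3) ≠ 0 := hy
    exact ((contDiffAt_norm ℝ hy').log (norm_ne_zero_iff.mpr hy')).contDiffWithinAt
  /- global cut-off representatives near `ξ` (for the core) and away from the centre (to read the tails) -/
  obtain ⟨V, hVC, hVU⟩ := OrderTwoBlowdown.exists_contDiff_eventuallyEq hU'C hξ0
  obtain ⟨Q, hQC, hQP⟩ := OrderTwoBlowdown.exists_contDiff_eventuallyEq hP'infC hξ0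
  obtain ⟨Ug, hUgC, hUg⟩ := OrderTwoLaw.exists_contDiff_far (hU.of_le (by norm_cast) : ContDiffOn ℝ 6 U {x₀}ᶜ)
  have hPlogC : ContDiffOn ℝ 2 (fun x : E3 => P₀ x + s₀ * Real.log ‖x - x₀‖) {x₀}ᶜ := by
    refine (hP.of_le (by norm_cast)).add (contDiffOn_const.mul ?_)
    intro x hx
    have hx' : x - x₀ ≠ 0 := sub_ne_zero.mpr hx
    exact (((contDiffAt_id.sub contDiffAt_const).norm ℝ hx').log (norm_ne_zero_iff.mpr hx')).contDiffWithinAt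
  obtain ⟨Pg, hPgC, hPg⟩ := OrderTwoLaw.exists_contDiff_far hPlogC
  /- reduce to sequences `ρₖ → ∞` -/
  refine tendsto_iff_seq_tendsto.mpr fun ρ hρ => ?_
  have hρ1 : ∀ᶠ k in atTop, (1 : ℝ) ≤ ρ k := hρ.eventually_ge_atTop 1
  /- JET DATA at `ξ`: velocity (six derivatives) -/
  have hhalf : ∀ᶠ y in 𝓝 ξ, (1 / 2 : ℝ) < ‖y‖ :=
    continuous_norm.continuousAt.eventually (Ioi_mem_nhds (by show (1 / 2 : ℝ) < ‖ξ‖; rw [hξ]; norm_num))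
  have hfar : ∀ (k : ℕ) (y : E3), 0 < ρ k → 1 ≤ ρ k → (1 / 2 : ℝ) < ‖y‖ → 1 / 2 < ‖(x₀ + ρ k • y) - x₀‖ := by
    intro k y hkpos hk hy
    rw [add_sub_cancel_left, norm_smul, Real.norm_eq_abs, abs_of_pos hkpos]
    nlinarith [norm_nonneg y]
  have hTV : ∀ᶠ k in atTop, (fun y : E3 => w (x₀ + ρ k • y) - V y) =ᶠ[𝓝 ξ]
      fun y => w (x₀ + ρ k • y) - Ug (x₀ + ρ k • y) := by
    filter_upwards [hρ1] with k hk
    have hkpos : 0 < ρ k := lt_of_lt_of_le one_pos hk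
    filter_upwards [hhalf, hVU] with y hy hVy
    rw [hVy, (hUg _ (hfar k y hkpos hk hy)).eq_of_nhds, hUhom (ρ k) hkpos y]
  have hV6 : ∀ j ≤ 6, Tendsto (fun k => ‖iteratedFDeriv ℝ j (fun y => w (x₀ + ρ k • y) - V y) ξ‖) atTop (𝓝 0) := by
    intro j hj
    refine OrderTwoLaw.tendsto_norm_iteratedFDeriv_rescale (n := 6) (C := C) hδ hξ0 (hws.of_le (by norm_cast))
      hUgC hj ?_ hρ hTV
    intro x hx
    have hx' : 1 / 2 < ‖x - x₀‖ := by linarith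
    have hev : (fun y => w y - Ug y) =ᶠ[𝓝 x] fun y => w y - U y := by
      filter_upwards [hUg x hx'] with y hy; rw [hy]
    rw [(hev.iteratedFDeriv ℝ j).eq_of_nhds]
    exact hTu j hj x hx
  /- JET DATA at `ξ`: pressure (two derivatives), constants `cₖ = s₀ log ρₖ` -/
  have hTQ : ∀ᶠ k in atTop, (fun y : E3 => (q (x₀ + ρ k • y) - s₀ * Real.log (ρ k)) - Q y) =ᶠ[𝓝 ξ]
      fun y => q (x₀ + ρ k • y) - Pg (x₀ + ρ k • y) := by
    filter_upwards [hρ1] with k hk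
    have hkpos : 0 < ρ k := lt_of_lt_of_le one_pos hk
    filter_upwards [hhalf, hQP] with y hy hQy
    have hypos : 0 < ‖y‖ := by linarith
    rw [hQy, (hPg _ (hfar k y hkpos hk hy)).eq_of_nhds, hPhom (ρ k) hkpos y, add_sub_cancel_left, norm_smul,
      Real.norm_eq_abs, abs_of_pos hkpos, Real.log_mul hkpos.ne' hypos.ne']
    simp only [hP']
    ring
  have hQ2 : ∀ j ≤ 2, Tendsto (fun k => ‖iteratedFDeriv ℝ j
      (fun y => (q (x₀ + ρ k • y) - s₀ * Real.log (ρ k)) - Q y) ξ‖) atTop (𝓝 0) := by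
    intro j hj
    refine OrderTwoLaw.tendsto_norm_iteratedFDeriv_rescale (n := 2) (C := C) hδ hξ0 (hqs.of_le (by norm_cast))
      hPgC hj ?_ hρ hTQ
    intro x hx
    have hx' : 1 / 2 < ‖x - x₀‖ := by linarith
    have hev : (fun y => q y - Pg y) =ᶠ[𝓝 x] fun y => q y - P₀ y - s₀ * Real.log ‖y - x₀‖ := by
      filter_upwards [hPg x hx'] with y hy; rw [hy]; ring
    rw [(hev.iteratedFDeriv ℝ j).eq_of_nhds]
    exact hTp j hj x hx
  /- the analytic core (layer (R)) along `ρₖ` -/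
  have hcore := OrderTwoBlowdown.tendsto_rescaled_loc2_sub_head hws hqs x₀ ξ hρ (fun k => s₀ * Real.log (ρ k))
    hVC hQC hV6 hQ2
  /- pressure drop-out: the head part of the limit vanishes -/
  have hRconstV : radialVirial (head V Q) 0 =ᶠ[𝓝 ξ] fun _ => s₀ :=
    OrderTwoBlowdown.radialVirial_head_eventuallyEq_const hξ0 hU'hom hP'hom (hU'C.differentiableOn (by norm_num))
      (hP'C.differentiableOn (by norm_num)) hVU hQP
  have hgrad0 : gradient (radialVirial (head V Q) 0) ξ = 0 := by
    rw [gradient, hRconstV.fderiv_eq, fderiv_fun_const, Pi.zero_apply, map_zero]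
  rw [hgrad0, inner_zero_right, sub_zero] at hcore
  /- identify the limit bracket with `horizonL2 U x₀ (x₀ + ξ)` (unit `ξ`, germ-locality, translation) -/
  have hL2 : horizonL2 U x₀ (x₀ + ξ) = inner ℝ ξ
      (curl (fun y => cross (cross (V y) (curl V y)) (curl V y)) ξ
        + curl (fun y => cross (V y) (curl (fun s => cross (V s) (curl V s)) y)) ξ) := by
    have h1 : horizonL2 U x₀ (x₀ + ξ) = horizonL2 U' 0 ξ := by
      have hfun : (fun z => U' (z - x₀)) = U := by
        funext z; simp only [hU', add_sub_cancel]
      have h := horizonL2_translate U' x₀ (x₀ + ξ)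
      rw [hfun, add_sub_cancel_left] at h
      exact h
    rw [h1, ← OrderTwoBlowdown.horizonL2_congr hVU]
    unfold horizonL2
    rw [sub_zero, hξ, one_pow, one_mul]
  rw [hL2]
  refine hcore.congr fun k => ?_
  simp only [Function.comp, hjet]

/-- The sketch Prop `OrderTwoHorizonLaw` (Theorems-side twin, `ThreadingFluxHorizonTowerDefs` l.158) HOLDS — by name. -/
theorem orderTwoHorizonLaw_holds : OrderTwoHorizonLaw := orderTwoHorizonLaw

/-- **BOUNDED-ENDPOINT TAIL RUNG, UNCONDITIONAL** (the sketch Prop `BoundedEndpointTailRung`, `ThreadingFluxHorizonTowerDefs`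
l.312, by name): the landed conditional rung `boundedEndpointTailRung_of_orderTwoHorizonLaw` composed with the lever just proved.
At an interior time of an open window unthreaded about `x₀`, a slice asymptotic to `c · horizonProfile l H x₀` (`c ≠ 0`, six
derivatives, power tail) with pressure `P₀ + s₀ log r + O(r^{−δ})` forces `𝔏₂[horizonProfile l H 0] ≡ 0` off the origin. -/
theorem boundedEndpointTailRung_holds : BoundedEndpointTailRung :=
  boundedEndpointTailRung_of_orderTwoHorizonLaw orderTwoHorizonLaw_holds


end Summit.NavierStokesRegularity.NavierStokesRegularity.Theorems.PoloidalLiouville.HorizonTower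

end
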